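import Summits.HubbardSuperconductivity.HubbardSuperconductivity.Theorems.AnisotropyChordTransferFibre3KT2aRow
import Summits.HubbardSuperconductivity.HubbardSuperconductivity.Theorems.AnisotropyChordTransferFibre3Resolvent

/-!
# Route `AnisotropyChord` / H0 rotor rung: PartN41-D §3 — `OffDTransform` PROVED (inclusion–exclusion on the hard-core lines)

Theory-1 g22's PartN41-D §3 `OffDTransform` (port …Fibre3KT2aRow): the transform of `1_{Dᶜ}·G` is the full transform minus the
boundary sums over the three lines `a = 0`, `b = 0`, `a = b` of `D`, which meet pairwise (and triply) only at the origin: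
`1_D = 1_{a=0} + 1_{b=0} + 1_{a=b} − 2·1_{(0,0)}` (★ `indicator_D`), whence ★ `offDTransform_holds : OffDTransform L`.
Prover seat `hubbard-h0-rotor-p1` g27 (route lead); helper for stmt-HubbardSuperconductivity-23918 (`--supports`, helper class).
WHAT THIS IS NOT: nothing here proves superconductivity in the Hubbard model.  Tree imports only; no new definitions; no sorry.
-/

set_option linter.dupNamespace false
set_option autoImplicit false

noncomputable section

open scoped BigOperators

namespace Summit.HubbardSuperconductivity.HubbardSuperconductivity.Theorems.AnisotropyChord.Transfer.Fibre3

variable (L : ℕ) [NeZero L]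

namespace RowD

omit [NeZero L] in
/-- ★ inclusion–exclusion for the hard core: `1_D = 1_{a=0} + 1_{b=0} + 1_{a=b} − 2·1_{(0,0)}`. [folklore] -/
theorem indicator_D (c : Cfg L) (x : ℂ) :
    (if InD L c then x else 0)
      = (if c.1 = 0 then x else 0) + (if c.2 = 0 then x else 0) + (if c.1 = c.2 then x else 0)
        - 2 * (if c = (0, 0) then x else 0) := by
  unfold InD
  have hc0 : c = (0, 0) ↔ c.1 = 0 ∧ c.2 = 0 := Prod.ext_iff
  by_cases h1 : c.1 = 0 <;> by_cases h2 : c.2 = 0 <;> by_cases h12 : c.1 = c.2 <;>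
    simp_all
  ring

end RowD

/-- ★ **`OffDTransform L` holds.** [folklore] -/
theorem offDTransform_holds : OffDTransform L := by
  classical
  intro G k₂ k₃
  -- `cfgDFT G − cfgDFT (1_{Dᶜ} G) = Σ_c w·G·1_D`
  have hsplit : cfgDFT L (fun c => if InD L c then 0 else G c) k₂ k₃
      = cfgDFT L G k₂ k₃ - ∑ c : Cfg L, (starRingEnd ℂ) (phase L k₂ c.1 * phase L k₃ c.2) * (if InD L c then G c else 0) := by
    unfold cfgDFT
    rw [← Finset.sum_sub_distrib]
    refine Finset.sum_congr rfl fun c _ => ?_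
    by_cases h : InD L c = true
    · simp only [h, if_true]; ring
    · simp only [h]; simp
  rw [hsplit]
  congr 1
  -- expand the indicator
  simp_rw [RowD.indicator_D L]
  simp only [mul_add, mul_sub, Finset.sum_add_distrib, Finset.sum_sub_distrib]
  -- the four pieces
  have p1 : ∑ c : Cfg L, (starRingEnd ℂ) (phase L k₂ c.1 * phase L k₃ c.2) * (if c.1 = 0 then G c else 0)
      = ∑ b : Tor L, (starRingEnd ℂ) (phase L k₃ b) * G (0, b) := by
    rw [Fintype.sum_prod_type, Finset.sum_comm]
    refine Finset.sum_congr rfl fun b _ => ?_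
    have : ∀ a : Tor L, (starRingEnd ℂ) (phase L k₂ (a, b).1 * phase L k₃ (a, b).2) * (if (a, b).1 = 0 then G (a, b) else 0)
        = if a = 0 then (starRingEnd ℂ) (phase L k₂ a * phase L k₃ b) * G (a, b) else 0 := by
      intro a; simp only; split_ifs <;> ring
    rw [Finset.sum_congr rfl fun a _ => this a, Finset.sum_ite_eq' Finset.univ (0 : Tor L)]
    simp only [Finset.mem_univ, if_true]
    rw [phase_zero, one_mul]
  have p2 : ∑ c : Cfg L, (starRingEnd ℂ) (phase L k₂ c.1 * phase L k₃ c.2) * (if c.2 = 0 then G c else 0)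
      = ∑ a : Tor L, (starRingEnd ℂ) (phase L k₂ a) * G (a, 0) := by
    rw [Fintype.sum_prod_type]
    refine Finset.sum_congr rfl fun a _ => ?_
    have : ∀ b : Tor L, (starRingEnd ℂ) (phase L k₂ (a, b).1 * phase L k₃ (a, b).2) * (if (a, b).2 = 0 then G (a, b) else 0)
        = if b = 0 then (starRingEnd ℂ) (phase L k₂ a * phase L k₃ b) * G (a, b) else 0 := by
      intro b; simp only; split_ifs <;> ring
    rw [Finset.sum_congr rfl fun b _ => this b, Finset.sum_ite_eq' Finset.univ (0 : Tor L)]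
    simp only [Finset.mem_univ, if_true]
    rw [phase_zero, mul_one]
  have p3 : ∑ c : Cfg L, (starRingEnd ℂ) (phase L k₂ c.1 * phase L k₃ c.2) * (if c.1 = c.2 then G c else 0)
      = ∑ a : Tor L, (starRingEnd ℂ) (phase L k₂ a * phase L k₃ a) * G (a, a) := by
    rw [Fintype.sum_prod_type]
    refine Finset.sum_congr rfl fun a _ => ?_
    have : ∀ b : Tor L, (starRingEnd ℂ) (phase L k₂ (a, b).1 * phase L k₃ (a, b).2) * (if (a, b).1 = (a, b).2 then G (a, b) else 0)
        = if a = b then (starRingEnd ℂ) (phase L k₂ a * phase L k₃ b) * G (a, b) else 0 := by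
      intro b; simp only; split_ifs <;> ring
    rw [Finset.sum_congr rfl fun b _ => this b, Finset.sum_ite_eq Finset.univ a]
    simp only [Finset.mem_univ, if_true]
  have p4 : ∑ c : Cfg L, (starRingEnd ℂ) (phase L k₂ c.1 * phase L k₃ c.2) * (2 * (if c = (0, 0) then G c else 0))
      = 2 * G (0, 0) := by
    have : ∀ c : Cfg L, (starRingEnd ℂ) (phase L k₂ c.1 * phase L k₃ c.2) * (2 * (if c = (0, 0) then G c else 0))
        = if c = (0, 0) then 2 * ((starRingEnd ℂ) (phase L k₂ c.1 * phase L k₃ c.2) * G c) else 0 := by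
      intro c; split_ifs <;> ring
    rw [Finset.sum_congr rfl fun c _ => this c, Finset.sum_ite_eq' Finset.univ ((0 : Tor L), (0 : Tor L))]
    simp only [Finset.mem_univ, if_true]
    rw [phase_zero, phase_zero, mul_one, map_one, one_mul]
  rw [p1, p2, p3, p4]

end Summit.HubbardSuperconductivity.HubbardSuperconductivity.Theorems.AnisotropyChord.Transfer.Fibre3

end
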